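import Literature.NumberTheory.EllipticCurves.DegreeConjectureAbcMurtyProofs
import Literature.NumberTheory.EllipticCurves.CongruenceNumberLevelBoundExplicitProofs
import Literature.NumberTheory.EllipticCurves.PastenSpectralDegree
import Literature.NumberTheory.EllipticCurves.ManinConstantSemistablePrimewise
import Literature.NumberTheory.EllipticCurves.NeronIsogenyScaling
import Literature.NumberTheory.EllipticCurves.CongruenceNumber
import Literature.NumberTheory.Automorphic.ShimuraCurveRibetTakahashi
import Literature.NumberTheory.DiophantineGeometry.AbcWave0
import HarnessLib

/-!
# Stub-ideation k1 (FAMILY 1 — recognise & import) for `stub_primeToSixDegreeBound`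
# (crux `DefiniteXi.SteinbergCore`, stmt-ABC-15024, line `p6_tamagawa_split`)

Helper-lemma SIGNATURES only (sorries allowed in `H*`); `P6` is the stub verbatim.
-/

noncomputable section

set_option linter.dupNamespace false

namespace Summit.ABC.ABC.Cruxes.SteinbergCore.StubIdeas1

open Literature.NumberTheory.EllipticCurves Literature.NumberTheory.EllipticCurves.ModularForms
open Literature.NumberTheory.DiophantineGeometry Literature.NumberTheory.Automorphic
open CongruenceSubgroup

/-- The stub, verbatim. -/
def P6 : Prop :=
  ∀ ε : ℝ, 0 < ε → ∃ C : ℝ, ∀ a b : ℤ, IsCoprime a b → a * b * (a + b) ≠ 0 → ∀ (N : ℕ) [NeZero N], (Literature.NumberTheory.EllipticCurves.freyCurve a b).conductorNorm ℤ = N → ∀ D : Literature.NumberTheory.EllipticCurves.ModularForms.ModularParametrizationData (Literature.NumberTheory.EllipticCurves.freyCurve a b) N, (∀ D' : Literature.NumberTheory.EllipticCurves.ModularForms.ModularParametrizationData (Literature.NumberTheory.EllipticCurves.freyCurve a b) N, D.deg ≤ D'.deg) → ((D.deg / (ordProj[2] D.deg * ordProj[3] D.deg) : ℕ) : ℝ)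 ≤ C * (N : ℝ) ^ (2 + ε)

/-- abc in the `≤`-currency of the Literature theorems. -/
def AbcLe : Prop :=
  ∀ ε : ℝ, 0 < ε → ∃ C : ℝ, ∀ a b c : ℕ, IsABCTriple a b c →
    (c : ℝ) ≤ C * ((rad a b c : ℕ) : ℝ) ^ (1 + ε)

/-- Petersson UPPER bound at every level, for every `η > 0` (Rankin–Selberg; in print;
square-free level PROVED: `exists_petersson_le_mul_log_pow_of_squarefree`). = `hUp` of
`abcLe_imp_freyDegreeConjecture_of_petersson_of_manin`, = `∀ θ>0, Summit.ABC.Analytic.PeterssonUpperRat θ`. -/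
def PeterssonUpperAll : Prop :=
  ∀ η : ℝ, 0 < η → ∃ C₂ : ℝ, ∀ (N : ℕ) [NeZero N] (W : WeierstrassCurve ℚ) [W.IsElliptic]
    (f : CuspForm (Gamma0 N) 2), IsNewformOf W f →
      (peterssonProduct (Gamma0 N) 2 f f).re ≤ C₂ * (N : ℝ) ^ (1 + η)

/-- Frey models carry data with uniformly bounded Manin constant (= `hM` of the Murty converse). -/
def FreyManinBound : Prop :=
  ∃ M : ℕ, ∀ a b : ℤ, IsCoprime a b → a * b * (a + b) ≠ 0 →
    ∀ (N : ℕ) [NeZero N], (freyCurve a b).conductorNorm ℤ = N →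
      ∃ D : ModularParametrizationData (freyCurve a b) N, D.maninConstant.natAbs ≤ M

/-- **F1 — named fact to vendor (Pasten 2024 = arXiv:1705.09251, Thm 1.3 / Thm 10.1 / Cor 10.2 with
`S = {2}`)**: the Manin constant of an OPTIMAL datum (lattice rendering `Λ_E ⊆ c Λ_f`, as in
`mazur_not_dvd_maninConstant_of_odd`) at a level squarefree away from `2` is uniformly bounded. -/
def PastenManinBoundAwayTwo : Prop :=
  ∃ M : ℕ, ∀ (W' : WeierstrassCurve ℚ) [W'.IsElliptic] [W'.IsGloballyMinimal] (N' : ℕ) [NeZero N']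
    (D' : ModularParametrizationData W' N'),
    (∀ z ∈ D'.L.lattice, ∃ w ∈ periodLattice D'.f, z = D'.c * w) →
    (∀ p : ℕ, p.Prime → p ≠ 2 → ¬ p ^ 2 ∣ N') → D'.maninConstant.natAbs ≤ M

/-- **H1 (kernel sandwich, upper slice) — PROVABLE NOW**: abc(≤) ⟹ P6 modulo the two fact-grade
inputs, by composing the tree's Murty-(ii) converse with the landed split lemma. -/
theorem p6_of_abcLe (hUp : PeterssonUpperAll) (hM : FreyManinBound) (habc : AbcLe) : P6 := by
  have hF := abcLe_imp_freyDegreeConjecture_of_petersson_of_manin hUp hM habc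
  intro ε hε
  obtain ⟨C, hC⟩ := hF ε hε
  refine ⟨C, fun a b hab h0 N _ hN D hDmin => ?_⟩
  obtain ⟨D₀, hD₀⟩ := hC a b hab h0 N hN
  have h0' : (((D.deg / (ordProj[2] D.deg * ordProj[3] D.deg) : ℕ) : ℝ)) ≤ (D.deg : ℝ) := by
    exact_mod_cast Nat.div_le_self _ _
  have h1 : (D.deg : ℝ) ≤ (D₀.deg : ℝ) := by exact_mod_cast hDmin D₀
  exact h0'.trans (h1.trans hD₀)

/-- **H2 (Frey transport of F1) — one prover cycle**: Frey conductors are squarefree away from `2`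
(`conductorNorm_freyCurve_dvd_holds`: `N ∣ 2⁸ rad`), the class-optimal datum exists on a globally
minimal model (`exists_optimal_modularParametrizationData`, = modularity), and a minimal isogeny
(`≤ 163`, `PastenShimura2024_minimalDegree_le_163_mul`) + Néron scaling
(`integral_neronScaling_of_isGloballyMinimal_holds`) + the model change Frey ↝ minimal (`u ∈ {1,2}`;
compose with `[2]` if needed) give a Frey datum with `|c| ≤ 2·163·M` — the argument of
`Summit.ABC.ABC.Theorems.maninBound_of_facts`, with Česnavičius replaced by F1. -/
theorem freyManinBound_of_facts (hOpt : exists_optimal_modularParametrizationData)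
    (hP : PastenManinBoundAwayTwo) (h163 : PastenShimura2024_minimalDegree_le_163_mul) :
    FreyManinBound := by
  sorry

/-- **H3 (unconditional rung, exponential) — one prover cycle**: `log cps(deg D) ≤ (1/5) N log N + K`
for minimal Frey data, from the PROVED `MurtyPasten.log_modularDegree_le_holds` (optimal degree),
Mazur–Kenku transport (`h163`) and `cps n ≤ n`. -/
theorem log_p6_le_fifth (hOpt : exists_optimal_modularParametrizationData)
    (h163 : PastenShimura2024_minimalDegree_le_163_mul) :
    ∃ K : ℝ, ∀ a b : ℤ, IsCoprime a b → a * b * (a + b) ≠ 0 →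
      ∀ (N : ℕ) [NeZero N], (freyCurve a b).conductorNorm ℤ = N →
        ∀ D : ModularParametrizationData (freyCurve a b) N,
          (∀ D' : ModularParametrizationData (freyCurve a b) N, D.deg ≤ D'.deg) →
            Real.log (((D.deg / (ordProj[2] D.deg * ordProj[3] D.deg) : ℕ) : ℝ))
              ≤ (1 / 5 : ℝ) * N * Real.log N + K := by
  sorry

/-- **H4 (Baker-class rung, subexponential) — one prover cycle given H2's output `hM`**:
`log cps(deg D) ≤ K · N^{1/3} (1 + log N)^3 + K`, from Zagier + Silverman
(`covolume_rpow_neg_six_le_of_isNeronLatticeOf`) + `max_c₄_c₆_freyCurve_le` (the unconditional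
half of Murty's §2: `deg D ≤ K₀ c_D² (f,f) max(|a|,|b|)`), any polynomial Petersson upper bound, and
the named fact `stewart_yu` (`log c ≪ rad^{1/3} log³ rad`, `rad ∣ 2N`). Ceiling: the exponent `1/3`
IS the Baker barrier (`Literature.Barriers.ABC.BakerMethodBounds_iff_stewartYu`). -/
theorem log_p6_le_of_stewartYu (hSY : stewart_yu)
    (hUp : ∃ A C₂ : ℝ, ∀ (N : ℕ) [NeZero N] (W : WeierstrassCurve ℚ) [W.IsElliptic]
      (f : CuspForm (Gamma0 N) 2), IsNewformOf W f →
        (peterssonProduct (Gamma0 N) 2 f f).re ≤ C₂ * (N : ℝ) ^ A)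
    (hM : FreyManinBound) :
    ∃ K : ℝ, ∀ a b : ℤ, IsCoprime a b → a * b * (a + b) ≠ 0 →
      ∀ (N : ℕ) [NeZero N], (freyCurve a b).conductorNorm ℤ = N →
        ∀ D : ModularParametrizationData (freyCurve a b) N,
          (∀ D' : ModularParametrizationData (freyCurve a b) N, D.deg ≤ D'.deg) →
            Real.log (((D.deg / (ordProj[2] D.deg * ordProj[3] D.deg) : ℕ) : ℝ))
              ≤ K * (N : ℝ) ^ (1 / 3 : ℝ) * (1 + Real.log N) ^ 3 + K := by
  sorry

/-- **H5 (ℓ-adic recognition) — one prover cycle**: at a level squarefree away from `{2,3}` the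
prime-to-6 parts of the optimal degree and of the congruence number AGREE (ARS 2012 Thm 2.1 (a)+(b),
tree facts `modularDegree_dvd_congruenceNumber`, `padicValNat_congruenceNumber_eq_of_not_sq_dvd`).
So P6 is the prime-to-6 SHARP CONGRUENCE-NUMBER conjecture on Frey newforms (cf.
`Summit.ABC.Analytic.SharpCongruenceNumberRat`, abc-equivalent: `sharpCongruenceNumberRat_iff_abc_of_facts`). -/
theorem cps_modularDegree_eq_cps_congruenceNumber (hR : modularDegree_dvd_congruenceNumber)
    (hARS : padicValNat_congruenceNumber_eq_of_not_sq_dvd) {N : ℕ} [NeZero N]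
    (hN : ∀ p : ℕ, p.Prime → 5 ≤ p → ¬ p ^ 2 ∣ N) {W : WeierstrassCurve ℚ} [W.IsElliptic]
    (D : ModularParametrizationData W N)
    (hopt : ∀ (W' : WeierstrassCurve ℚ) [W'.IsElliptic] (D' : ModularParametrizationData W' N),
      D'.f = D.f → D.modularDegree ≤ D'.modularDegree) :
    D.modularDegree / (ordProj[2] D.modularDegree * ordProj[3] D.modularDegree)
      = congruenceNumber D.f / (ordProj[2] (congruenceNumber D.f) * ordProj[3] (congruenceNumber D.f)) := by
  sorry

end Summit.ABC.ABC.Cruxes.SteinbergCore.StubIdeas1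

end
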